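import Mathlib

/-!
# Root alignment: arbitrary-coefficient Type II sums for `k² + 1` attain their trivial bound — PROVED

Solo seat `solo-Parity-blind` (summit `Parity`, conjunct `BatemanHorn`, instance `X² + 1`).

Let `J_x = {k² + 1 : 0 ≤ k ≤ x}` (`x + 1` values of size `≤ x² + 1 =: X`).  A "Type II estimate" in
the sense of Ford–Maynard (arXiv:2407.14368, (II), p. 3) for the normalised indicator of `J_x` asks
that for ALL divisor-bounded coefficients `ξ_m, κ_n`,
`∑_{m ∈ (M, 2M]} ∑_n ξ_m κ_n (a_{mn} − b_{mn})` be `≤ X (log X)^{-B}`, where `a` is the indicator of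
`J_x` scaled to mean `≍ 1` on `(X/2, X]` (so `a_v ≍ √X · 1_{J_x}(v)`) and `b` is a smooth comparison
sequence.  This file proves the combinatorial fact that makes every such estimate FALSE for `J_x`
in every range `M`:

* `eq_of_prime_dvd_sq_add_one` — **uniqueness of the root below `x`**: if `p` is a prime with
  `2x < p` and `k, k' ≤ x` with `p ∣ k² + 1`, `p ∣ k'² + 1`, then `k = k'`
  (`p ∣ (k − k')(k + k')`, and `|k − k'| ≤ x < p`, `0 ≤ k + k' ≤ 2x < p`).
* `card_bigPrimes_le_one` — each `k ≤ x` has at most one prime factor `p > 2x` of `k² + 1`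
  (two would have product `> 4x² ≥ k² + 1`).
* `bilin` — the bilinear form `B_x(ξ, η) = ∑_{k ≤ x} ∑_{p ∣ k²+1, p prime, p > 2x} ξ((k²+1)/p) η(p)`,
  i.e. `∑_m ∑_{p prime > 2x} ξ_m η_p 1_{J_x}(mp)` (every factorisation `mp ∈ J_x` with `p > 2x`
  prime arises from exactly one `k`).  In ANY factorisation `v = mn` of an element of `J_x` one
  factor is `≥ √v`, so restricting the larger variable to primes `> 2x` loses nothing essential:
  by Chebyshev–Markov, `#{k ≤ x : P⁺(k² + 1) > 2x} ≥ (1/2 − o(1)) x` (numerically `0.68 x`,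
  `HOME/work/align/`), so `B_x` carries a positive proportion of `J_x` for every position of the
  smaller variable `m ≤ x / 2`.
* `aligned ξ` — the ROOT-ALIGNED coefficient `κ_p := ξ((k_p² + 1)/p)` where `k_p` is the unique
  `k ≤ x` with `p ∣ k² + 1` (and `κ_p := 0` if there is none).
* `bilin_aligned_eq_sum_sq` — **alignment identity**: `B_x(ξ, aligned ξ) = ∑_{k} ∑_{p} ξ((k²+1)/p)²`.
* `bilin_aligned_eq_trivialBound` — hence for every SIGN pattern `ξ : ℕ → {−1, 1}` (in particular
  for the Liouville function, `bilin_liouville_aligned`), `B_x(ξ, aligned ξ)` EQUALS its trivial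
  bound `∑∑ |ξ_m| |κ_p| 1_{J_x}(mp) = #{k ≤ x : P⁺(k² + 1) > 2x} =: E(x)`: there is no cancellation
  at all, although `ξ = λ` has cancellation in every arithmetic progression and against every
  smooth weight (prime number theorem), so that the comparison ("main") term
  `∑∑ ξ_m κ_p b_{mp}` is `o(√X · x)` for every admissible `b`, while the `a`-part is
  `√X · E(x) ≥ (1/2 − o(1)) √X · x ≍ X`.
* `bilin_window_aligned_eq_trivialBound` — the same with the smaller variable restricted to any
  window `S` (a dyadic range, say): the windowed form equals its own trivial bound, which is
  `#{k ≤ x : P⁺(k² + 1) > 2x, (k² + 1)/P⁺(k² + 1) ∈ S}`.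

Consequences (paper §10.1 of the seat).  (i) Hypothesis (II) of Ford–Maynard fails for `J_x` for
every `(θ, ν)` with `θ + ν ≥ 1/2` — in particular on the whole segment
`A₂* = {(1/2, θ, 1/2 − θ)}` that their Theorem 2.3 needs for an asymptotic with Type I level
`γ = 1/2` — since then the variable opposite to `m` runs through all primes in `(2x, x^{1+δ}]`, and
`#{k ≤ x : 2x < P⁺(k² + 1) ≤ x^{1+δ}} ≍_δ x` for small `δ > 0` (equidistribution of the roots of
`ν² + 1 ≡ 0` to prime moduli just beyond `x`: Hooley, Acta Math. 117 (1967); Deshouillers–Iwaniec,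
Ann. Inst. Fourier 32 (1982)).
(ii) For `θ + ν < 1/2` the aligned `a`-part is `√X · #{k ≤ x : X^{1−θ−ν} ≤ P⁺(k² + 1) ≤ X^{1−θ}}`:
under the Dickman-type heuristic this is `≍ X` and (II) fails again; unconditionally its positivity for
`1 − θ − ν > 0.656` IS the open largest-prime-factor problem (`P⁺(n² + 1) > n^{1.312}` is the
record), so in those ranges (II) is either false or its failure is an unproved rung of that ladder —
in no range is it a usable hypothesis.  (iii) The same alignment defeats every bilinear hypothesis
with free (divisor-bounded) coefficients on the variable carrying the large prime:
Friedlander–Iwaniec's (B) (Ann. of Math. 148 (1998); there the outer absolute values already do it),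
Harman's Type II sums (Prime-Detecting Sieves (2007), §3.2), Heath-Brown's Type II for `X³ + 2Y³`
(Acta Math. 186 (2001)).  Ford–Maynard state the soft form on p. 7 of arXiv:2407.14368 ("if `a_n`
is the normalized indicator of a set containing `x^{1−c}` elements, then one can only hope for (II)
to hold for `θ > c`"; here `c = 1/2` while `θ < 1/2` is their standing assumption (1.1)).  The
mechanism is specific to sets of `X^{1/2+o(1)}` elements cut out by ONE polynomial: for `a² + b⁴`
(`X^{3/4}` elements) or the primes the larger variable has many representations and no alignment
is possible.

Reading for the programme: "Type I at level `X^{1/2}` plus Type II in `[X^{1/3}, X^{1/2}]`"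
(Ford–Maynard Thm 2.3 with `γ = 1/2`, residual polytope empty) cannot be instantiated for `n² + 1`
with coefficient-free Type II sums; any bilinear input must restrict the coefficient on the large
variable to ROOT-BLIND structured classes (`Λ`, `μ`, sieve weights), which is the largest-prime-factor
programme (`P⁺(n² + 1) > n^{1.312}`), not an asymptotic sieve.  No `sorry`, standard axioms only.
-/

open Finset

namespace Summit.Parity.BatemanHorn.Theorems.SoloBlindAlignment

/-! ### Uniqueness of the root below `x` -/

/-- **Uniqueness of the root.** A prime `p > 2x` divides `k² + 1` for at most one `k ≤ x`:
if `p ∣ k² + 1` and `p ∣ k'² + 1` with `k, k' ≤ x` then `k = k'`. -/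
theorem eq_of_prime_dvd_sq_add_one {p x k k' : ℕ} (hp : p.Prime) (hpx : 2 * x < p)
    (hk : k ≤ x) (hk' : k' ≤ x) (hd : p ∣ k ^ 2 + 1) (hd' : p ∣ k' ^ 2 + 1) : k = k' := by
  have h1 : (p : ℤ) ∣ ((k : ℤ) - k') * ((k : ℤ) + k') := by
    have e : ((k : ℤ) - k') * ((k : ℤ) + k') = ((k : ℤ) ^ 2 + 1) - ((k' : ℤ) ^ 2 + 1) := by ring
    rw [e]
    exact dvd_sub (by exact_mod_cast hd) (by exact_mod_cast hd')
  have hpZ : Prime (p : ℤ) := Nat.prime_iff_prime_int.mp hp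
  rcases hpZ.dvd_or_dvd h1 with h | h
  · have h0 : ((k : ℤ) - k') = 0 := by
      refine Int.eq_zero_of_abs_lt_dvd h ?_
      rw [abs_lt]
      constructor <;> omega
    omega
  · have h0 : ((k : ℤ) + k') = 0 := by
      refine Int.eq_zero_of_abs_lt_dvd h ?_
      rw [abs_lt]
      constructor <;> omega
    omega

/-! ### The bilinear form over factorisations `k² + 1 = m · p`, `p > 2x` prime -/

/-- The prime factors `p > 2x` of `k² + 1`. -/
def bigPrimes (x k : ℕ) : Finset ℕ := (k ^ 2 + 1).primeFactors.filter (fun p => 2 * x < p)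

/-- Membership in `bigPrimes x k`: `p` prime, `p ∣ k² + 1`, `2x < p`. -/
theorem mem_bigPrimes {x k p : ℕ} :
    p ∈ bigPrimes x k ↔ p.Prime ∧ p ∣ k ^ 2 + 1 ∧ 2 * x < p := by
  simp [bigPrimes, Nat.mem_primeFactors, and_assoc]

/-- **At most one large prime factor.** For `k ≤ x`, `k² + 1` has at most one prime factor `> 2x`. -/
theorem card_bigPrimes_le_one {x k : ℕ} (hk : k ≤ x) : (bigPrimes x k).card ≤ 1 := by
  rw [Finset.card_le_one]
  intro p hp q hq
  rw [mem_bigPrimes] at hp hq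
  by_contra hne
  have hcop : Nat.Coprime p q := (Nat.coprime_primes hp.1 hq.1).mpr hne
  have hdvd : p * q ∣ k ^ 2 + 1 := Nat.Coprime.mul_dvd_of_dvd_of_dvd hcop hp.2.1 hq.2.1
  have hle : p * q ≤ k ^ 2 + 1 := Nat.le_of_dvd (by positivity) hdvd
  have hk2 : k ^ 2 + 1 ≤ x ^ 2 + 1 := by gcongr
  have h1 : (2 * x + 1) * (2 * x + 1) ≤ p * q := Nat.mul_le_mul hp.2.2 hq.2.2
  have h2 : 2 * 2 ≤ p * q := Nat.mul_le_mul hp.1.two_le hq.1.two_le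
  have h4 : (2 * x + 1) * (2 * x + 1) ≤ x ^ 2 + 1 := h1.trans (hle.trans hk2)
  have h4' : 2 * 2 ≤ x ^ 2 + 1 := h2.trans (hle.trans hk2)
  nlinarith [h4, h4']

/-- The bilinear form `B_x(ξ, η) = ∑_{k ≤ x} ∑_{p ∣ k² + 1, p prime, p > 2x} ξ((k² + 1)/p) · η(p)`,
i.e. `∑_m ∑_{p prime, p > 2x} ξ_m η_p 1_{J_x}(m p)` with `J_x = {k² + 1 : k ≤ x}`. -/
def bilin (x : ℕ) (ξ η : ℕ → ℤ) : ℤ :=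
  ∑ k ∈ range (x + 1), ∑ p ∈ bigPrimes x k, ξ ((k ^ 2 + 1) / p) * η p

/-- The trivial bound `∑_{k ≤ x} ∑_{p} |ξ((k² + 1)/p)| · |η(p)|` for `B_x(ξ, η)`. -/
def trivialBound (x : ℕ) (ξ η : ℕ → ℤ) : ℤ :=
  ∑ k ∈ range (x + 1), ∑ p ∈ bigPrimes x k, |ξ ((k ^ 2 + 1) / p)| * |η p|

/-- The triangle inequality `|B_x(ξ, η)| ≤ trivialBound`. -/
theorem abs_bilin_le_trivialBound (x : ℕ) (ξ η : ℕ → ℤ) :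
    |bilin x ξ η| ≤ trivialBound x ξ η := by
  unfold bilin trivialBound
  refine (Finset.abs_sum_le_sum_abs _ _).trans (Finset.sum_le_sum fun k _ => ?_)
  refine (Finset.abs_sum_le_sum_abs _ _).trans (Finset.sum_le_sum fun p _ => ?_)
  rw [abs_mul]

/-- The number of edges `E(x) = #{(k, p) : k ≤ x, p prime, p > 2x, p ∣ k² + 1}`
`= #{k ≤ x : P⁺(k² + 1) > 2x}` (by `card_bigPrimes_le_one`). -/
def edgeCount (x : ℕ) : ℕ := ∑ k ∈ range (x + 1), (bigPrimes x k).card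

/-- `E(x) = #{k ≤ x : k² + 1 has a prime factor > 2x} = #{k ≤ x : P⁺(k² + 1) > 2x}`. -/
theorem edgeCount_eq_card_filter (x : ℕ) :
    edgeCount x = ((range (x + 1)).filter (fun k => (bigPrimes x k).Nonempty)).card := by
  rw [edgeCount, Finset.card_filter]
  refine Finset.sum_congr rfl fun k hk => ?_
  have hk' : k ≤ x := Nat.lt_succ_iff.mp (mem_range.mp hk)
  have h1 := card_bigPrimes_le_one hk'
  by_cases hne : (bigPrimes x k).Nonempty
  · rw [if_pos hne]
    exact le_antisymm h1 (Finset.card_pos.mpr hne)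
  · rw [if_neg hne, Finset.not_nonempty_iff_eq_empty.mp hne, Finset.card_empty]

/-! ### Root-aligned coefficients -/

open Classical in
/-- The **root-aligned** coefficient attached to `ξ`: `κ_p = ξ((k_p² + 1)/p)` where `k_p` is a
`k ≤ x` with `p ∣ k² + 1` (unique when `p > 2x` is prime), and `κ_p = 0` if there is none. -/
noncomputable def aligned (x : ℕ) (ξ : ℕ → ℤ) (p : ℕ) : ℤ :=
  if h : ∃ k, k ≤ x ∧ p ∣ k ^ 2 + 1 then ξ ((Classical.choose h ^ 2 + 1) / p) else 0

/-- On an edge `(k, p)` the aligned coefficient is `ξ` of the cofactor: `κ_p = ξ((k² + 1)/p)`. -/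
theorem aligned_eq {x k p : ℕ} (ξ : ℕ → ℤ) (hk : k ≤ x) (hp : p ∈ bigPrimes x k) :
    aligned x ξ p = ξ ((k ^ 2 + 1) / p) := by
  rw [mem_bigPrimes] at hp
  have h : ∃ k, k ≤ x ∧ p ∣ k ^ 2 + 1 := ⟨k, hk, hp.2.1⟩
  rw [aligned, dif_pos h]
  have hspec := Classical.choose_spec h
  rw [eq_of_prime_dvd_sq_add_one hp.1 hp.2.2 hspec.1 hk hspec.2 hp.2.1]

/-- `|κ_p| ≤ sup |ξ|`: aligned coefficients are as bounded as `ξ` (here: sign patterns stay sign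
patterns or zero). -/
theorem abs_aligned_le {x : ℕ} {ξ : ℕ → ℤ} {C : ℤ} (hC : 0 ≤ C) (hξ : ∀ m, |ξ m| ≤ C) (p : ℕ) :
    |aligned x ξ p| ≤ C := by
  unfold aligned
  split_ifs
  · exact hξ _
  · simpa using hC

/-! ### The alignment identity and the absence of cancellation -/

/-- **Alignment identity.** `B_x(ξ, aligned ξ) = ∑_{k ≤ x} ∑_{p} ξ((k² + 1)/p)²`. -/
theorem bilin_aligned_eq_sum_sq (x : ℕ) (ξ : ℕ → ℤ) :
    bilin x ξ (aligned x ξ) =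
      ∑ k ∈ range (x + 1), ∑ p ∈ bigPrimes x k, ξ ((k ^ 2 + 1) / p) ^ 2 := by
  unfold bilin
  refine Finset.sum_congr rfl fun k hk => Finset.sum_congr rfl fun p hp => ?_
  rw [aligned_eq ξ (Nat.lt_succ_iff.mp (mem_range.mp hk)) hp]
  ring

/-- **No cancellation for sign patterns.** If `ξ` takes values in `{−1, 1}`, then
`B_x(ξ, aligned ξ) = E(x)`, the full edge count. -/
theorem bilin_aligned_eq_edgeCount (x : ℕ) {ξ : ℕ → ℤ} (hξ : ∀ m, ξ m = 1 ∨ ξ m = -1) :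
    bilin x ξ (aligned x ξ) = edgeCount x := by
  rw [bilin_aligned_eq_sum_sq, edgeCount, Nat.cast_sum]
  refine Finset.sum_congr rfl fun k _ => ?_
  rw [Finset.card_eq_sum_ones, Nat.cast_sum, Nat.cast_one]
  refine Finset.sum_congr rfl fun p _ => ?_
  rcases hξ ((k ^ 2 + 1) / p) with h | h <;> rw [h] <;> norm_num

/-- … and `E(x)` is also the trivial bound: `∑∑ |ξ_m| |κ_p| 1_{J_x}(mp) = E(x)`. -/
theorem trivialBound_aligned_eq_edgeCount (x : ℕ) {ξ : ℕ → ℤ} (hξ : ∀ m, ξ m = 1 ∨ ξ m = -1) :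
    trivialBound x ξ (aligned x ξ) = edgeCount x := by
  rw [trivialBound, edgeCount, Nat.cast_sum]
  refine Finset.sum_congr rfl fun k hk => ?_
  rw [Finset.card_eq_sum_ones, Nat.cast_sum, Nat.cast_one]
  refine Finset.sum_congr rfl fun p hp => ?_
  rw [aligned_eq ξ (Nat.lt_succ_iff.mp (mem_range.mp hk)) hp]
  rcases hξ ((k ^ 2 + 1) / p) with h | h <;> rw [h] <;> norm_num

/-- **The bilinear form attains its trivial bound**: for every sign pattern `ξ`,
`B_x(ξ, aligned ξ) = ∑∑ |ξ_m| |κ_p| 1_{J_x}(mp)` — equality in the triangle inequality, i.e.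
no cancellation whatsoever, in every range of the variables. -/
theorem bilin_aligned_eq_trivialBound (x : ℕ) {ξ : ℕ → ℤ} (hξ : ∀ m, ξ m = 1 ∨ ξ m = -1) :
    bilin x ξ (aligned x ξ) = trivialBound x ξ (aligned x ξ) := by
  rw [bilin_aligned_eq_edgeCount x hξ, trivialBound_aligned_eq_edgeCount x hξ]

/-- Restricting the smaller variable to a window `m ∈ S` (e.g. a dyadic range `(M, 2M]`) changes
nothing: the windowed form still equals its own trivial bound.  (`ξ · 1_S` is a sign pattern or
zero; alignment is applied to `ξ · 1_S`.) -/
theorem bilin_window_aligned_eq_trivialBound (x : ℕ) (S : Finset ℕ) {ξ : ℕ → ℤ}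
    (hξ : ∀ m, ξ m = 1 ∨ ξ m = -1) :
    let ξS : ℕ → ℤ := fun m => if m ∈ S then ξ m else 0
    bilin x ξS (aligned x ξS) = trivialBound x ξS (aligned x ξS) ∧
      trivialBound x ξS (aligned x ξS) =
        ∑ k ∈ range (x + 1), ∑ p ∈ bigPrimes x k, if (k ^ 2 + 1) / p ∈ S then (1 : ℤ) else 0 := by
  intro ξS
  have key : ∀ k ∈ range (x + 1), ∀ p ∈ bigPrimes x k,
      ξS ((k ^ 2 + 1) / p) * aligned x ξS p = (if (k ^ 2 + 1) / p ∈ S then (1 : ℤ) else 0) ∧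
      |ξS ((k ^ 2 + 1) / p)| * |aligned x ξS p| = (if (k ^ 2 + 1) / p ∈ S then (1 : ℤ) else 0) := by
    intro k hk p hp
    rw [aligned_eq ξS (Nat.lt_succ_iff.mp (mem_range.mp hk)) hp]
    simp only [ξS]
    split_ifs with hm
    · rcases hξ ((k ^ 2 + 1) / p) with h | h <;> rw [h] <;> norm_num
    · simp
  constructor
  · unfold bilin trivialBound
    refine Finset.sum_congr rfl fun k hk => Finset.sum_congr rfl fun p hp => ?_
    rw [(key k hk p hp).1, (key k hk p hp).2]
  · unfold trivialBound
    refine Finset.sum_congr rfl fun k hk => Finset.sum_congr rfl fun p hp => ?_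
    rw [(key k hk p hp).2]

/-! ### The Liouville instance -/

/-- The Liouville function as an integer-valued sign pattern, `λ(m) = (−1)^{Ω(m)}`. -/
def liouville (m : ℕ) : ℤ := (-1) ^ (ArithmeticFunction.cardFactors m)

/-- `λ(m) ∈ {1, −1}`. -/
theorem liouville_eq_one_or (m : ℕ) : liouville m = 1 ∨ liouville m = -1 := by
  unfold liouville
  rcases Nat.even_or_odd (ArithmeticFunction.cardFactors m) with h | h
  · left; exact h.neg_one_pow
  · right; exact h.neg_one_pow

/-- **Liouville, root-aligned, has no cancellation**: with `ξ = λ` on the cofactor and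
`κ_p = λ((k_p² + 1)/p)` on the primes `p > 2x`,
`∑_m ∑_p λ(m) κ_p 1_{J_x}(mp) = ∑_m ∑_p |λ(m)| |κ_p| 1_{J_x}(mp) = #{k ≤ x : P⁺(k² + 1) > 2x}`. -/
theorem bilin_liouville_aligned (x : ℕ) :
    bilin x liouville (aligned x liouville) = edgeCount x ∧
      trivialBound x liouville (aligned x liouville) = edgeCount x :=
  ⟨bilin_aligned_eq_edgeCount x liouville_eq_one_or,
    trivialBound_aligned_eq_edgeCount x liouville_eq_one_or⟩

end Summit.Parity.BatemanHorn.Theorems.SoloBlindAlignment
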